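import Mathlib
import Literature.Computability.AlgebraicComplexity.NewtonPolygonTau

/-!
# `NewtonTauWeak` (stmt-ValiantsHypothesis-5904), line `euler-wronskian-vdp`: the objects of the line

Route-posited objects (D-0016 `…Defs` file) for the ultrametric Voorhoeve–van der Poorten line of the crux
`Summit.ValiantsHypothesis.ValiantsHypothesis.Theses.NewtonUnitEquations.NewtonTauWeak` (KPTT
arXiv:1308.2286, Conj. 1 in the weak form of their Thm 1), as fixed by the crux-plan skeleton
`Cruxes/NewtonTauWeak/Lines/euler_wronskian_vdp.lean` and the lead's reshape (gen 1): `Slope = ℂ[μ]`,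
`baseChange`, the Euler weight `eulerWeight e = e₀ + μ e₁`, the Euler derivation `euler` (`X^e ↦ ⟨ν,e⟩ X^e`),
`eulerWronskian u = det[θ^a u_b]`, `wronskianSup`, the flag Wronskians `flagW u j = W(u_0,…,u_{j-1})`; real
weights `wdeg w e = w₀e₀ + w₁e₁`, genericity `IsGeneric w`, the strict top predicate `IsTop w p e`; and the
routine API (coefficients/linearity/iterates of `euler`, base change, uniqueness/existence of tops).
Everything is a definition or a routine lemma [folklore]; the Wronskian method is Koiran–Portier–Tavenas
arXiv:1205.1015 (real zeros), transcribed to Newton polygons by `Cruxes/NewtonTauWeak/Lines/euler-wronskian-vdp.md`.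
-/

-- the namespace mandated for this Theorems file repeats the component `ValiantsHypothesis`
set_option linter.dupNamespace false

noncomputable section

namespace Summit.ValiantsHypothesis.ValiantsHypothesis.Theorems.NewtonTauWeakVdp

open scoped BigOperators Polynomial
open MvPolynomial
open Literature.Computability.AlgebraicComplexity (newtonVertexCount)

/-! ## The slope ring, base change, Euler derivation, Euler–Wronskians -/

/-- The slope ring `ℂ[μ]`: the probing direction is `ν = (1, μ)` with `μ` an indeterminate. [folklore] -/
abbrev Slope : Type := ℂ[X]

/-- Base change `ℂ[X,Y] → ℂ[μ][X,Y]` (coefficientwise `Polynomial.C`; support-preserving). [folklore] -/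
def baseChange (p : MvPolynomial (Fin 2) ℂ) : MvPolynomial (Fin 2) Slope :=
  MvPolynomial.map Polynomial.C p

/-- The Euler weight `⟨ν, e⟩ = e₀ + μ·e₁ ∈ ℂ[μ]` of an exponent vector. [folklore] -/
def eulerWeight (e : Fin 2 →₀ ℕ) : Slope :=
  Polynomial.C ((e 0 : ℕ) : ℂ) + Polynomial.X * Polynomial.C ((e 1 : ℕ) : ℂ)

/-- The Euler derivation `θ = X∂_X + μ·Y∂_Y` on `ℂ[μ][X,Y]`: `X^e ↦ ⟨ν,e⟩·X^e`. [folklore] -/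
def euler (p : MvPolynomial (Fin 2) Slope) : MvPolynomial (Fin 2) Slope :=
  ∑ e ∈ p.support, monomial e (eulerWeight e * coeff e p)

/-- The Euler–Wronskian `W(u_0,…,u_{r-1}) = det[θ^a u_b]_{a,b<r}` of a finite family. [folklore] -/
def eulerWronskian {r : ℕ} (u : Fin r → MvPolynomial (Fin 2) Slope) : MvPolynomial (Fin 2) Slope :=
  Matrix.det (Matrix.of fun a b : Fin r => (euler^[(a : ℕ)]) (u b))

/-- `max_{T ⊆ [k]} V(W(u_T))` — the largest Newton-polygon vertex count among the Euler–Wronskians of the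
sub-families of `u` (each sub-family enumerated increasingly; `T = ∅` gives `W = 1`). [folklore] -/
def wronskianSup {k : ℕ} (u : Fin k → MvPolynomial (Fin 2) ℂ) : ℕ :=
  Finset.univ.sup fun T : Finset (Fin k) =>
    newtonVertexCount (eulerWronskian fun b : Fin T.card => baseChange (u (T.orderEmbOfFin rfl b)))

/-- The flag Euler–Wronskians `W_j = W(u_0,…,u_{j-1})`, `j = 0,…,k` (`W_0 = 1`). [folklore] -/
def flagW {k : ℕ} (u : Fin k → MvPolynomial (Fin 2) ℂ) (j : Fin (k + 1)) : MvPolynomial (Fin 2) Slope :=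
  eulerWronskian fun b : Fin (j : ℕ) => baseChange (u (Fin.castLE (Nat.lt_succ_iff.mp j.isLt) b))

/-! ## Real weights, genericity, strict tops -/

/-- The weighted degree `⟨w, e⟩ = w₀ e₀ + w₁ e₁` of an exponent for a real weight `w`. [folklore] -/
def wdeg (w : Fin 2 → ℝ) (e : Fin 2 →₀ ℕ) : ℝ :=
  w 0 * ((e 0 : ℕ) : ℝ) + w 1 * ((e 1 : ℕ) : ℝ)

/-- A weight is generic when `e ↦ ⟨w, e⟩` is injective on all of `ℕ²` (e.g. `w₁/w₀ ∉ ℚ`). [folklore] -/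
def IsGeneric (w : Fin 2 → ℝ) : Prop :=
  Function.Injective (wdeg w)

/-- `e` is THE strict `w`-top exponent of `p`: it lies in the support and beats every other support
exponent strictly. [folklore] -/
def IsTop {R : Type*} [CommSemiring R] (w : Fin 2 → ℝ) (p : MvPolynomial (Fin 2) R) (e : Fin 2 →₀ ℕ) :
    Prop :=
  e ∈ p.support ∧ ∀ e' ∈ p.support, e' ≠ e → wdeg w e' < wdeg w e

/-! ## API: weights -/

/-- `wdeg` is additive in the exponent. [folklore] -/
theorem wdeg_add (w : Fin 2 → ℝ) (a b : Fin 2 →₀ ℕ) : wdeg w (a + b) = wdeg w a + wdeg w b := by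
  simp only [wdeg, Finsupp.add_apply, Nat.cast_add]
  ring

/-- `wdeg w 0 = 0`. [folklore] -/
@[simp] theorem wdeg_zero (w : Fin 2 → ℝ) : wdeg w 0 = 0 := by
  simp [wdeg]

/-- `wdeg` is homogeneous in the weight. [folklore] -/
theorem wdeg_smul (c : ℝ) (w : Fin 2 → ℝ) (e : Fin 2 →₀ ℕ) : wdeg (c • w) e = c * wdeg w e := by
  simp only [wdeg, Pi.smul_apply, smul_eq_mul]
  ring

/-- `wdeg` of a sum of exponents. [folklore] -/
theorem wdeg_sum {ι : Type*} (w : Fin 2 → ℝ) (s : Finset ι) (e : ι → (Fin 2 →₀ ℕ)) :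
    wdeg w (∑ i ∈ s, e i) = ∑ i ∈ s, wdeg w (e i) := by
  classical
  induction s using Finset.induction_on with
  | empty => simp
  | insert a s ha ih => rw [Finset.sum_insert ha, Finset.sum_insert ha, wdeg_add, ih]

/-- A nonzero multiple of a generic weight is generic. [folklore] -/
theorem IsGeneric.smul {w : Fin 2 → ℝ} (hw : IsGeneric w) {c : ℝ} (hc : c ≠ 0) : IsGeneric (c • w) := by
  intro a b h
  rw [wdeg_smul, wdeg_smul] at h
  exact hw (mul_left_cancel₀ hc h)

/-! ## API: tops -/

section Top

variable {R : Type*} [CommSemiring R]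

/-- A top exponent lies in the support. [folklore] -/
theorem IsTop.mem {w : Fin 2 → ℝ} {p : MvPolynomial (Fin 2) R} {e : Fin 2 →₀ ℕ} (h : IsTop w p e) :
    e ∈ p.support := h.1

/-- A top exponent beats every other support exponent. [folklore] -/
theorem IsTop.lt {w : Fin 2 → ℝ} {p : MvPolynomial (Fin 2) R} {e : Fin 2 →₀ ℕ} (h : IsTop w p e)
    {e' : Fin 2 →₀ ℕ} (he' : e' ∈ p.support) (hne : e' ≠ e) : wdeg w e' < wdeg w e := h.2 e' he' hne

/-- A top exponent is weakly above every support exponent. [folklore] -/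
theorem IsTop.le {w : Fin 2 → ℝ} {p : MvPolynomial (Fin 2) R} {e : Fin 2 →₀ ℕ} (h : IsTop w p e)
    {e' : Fin 2 →₀ ℕ} (he' : e' ∈ p.support) : wdeg w e' ≤ wdeg w e := by
  by_cases hne : e' = e
  · rw [hne]
  · exact (h.lt he' hne).le

/-- A polynomial with a top is nonzero. [folklore] -/
theorem IsTop.ne_zero {w : Fin 2 → ℝ} {p : MvPolynomial (Fin 2) R} {e : Fin 2 →₀ ℕ} (h : IsTop w p e) :
    p ≠ 0 := by
  rintro rfl
  simp [IsTop] at h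

/-- The top exponent is unique. [folklore] -/
theorem IsTop.unique {w : Fin 2 → ℝ} {p : MvPolynomial (Fin 2) R} {e e' : Fin 2 →₀ ℕ}
    (h : IsTop w p e) (h' : IsTop w p e') : e = e' := by
  by_contra hne
  have h1 := h.lt h'.mem (Ne.symm hne)
  have h2 := h'.lt h.mem hne
  exact lt_asymm h1 h2

/-- `IsTop` depends only on the support. [folklore] -/
theorem isTop_congr_support {S : Type*} [CommSemiring S] {w : Fin 2 → ℝ} {p : MvPolynomial (Fin 2) R}
    {q : MvPolynomial (Fin 2) S} (h : p.support = q.support) (e : Fin 2 →₀ ℕ) :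
    IsTop w p e ↔ IsTop w q e := by
  simp only [IsTop, h]

/-- For a generic weight every nonzero polynomial has a (unique) top exponent. [folklore] -/
theorem exists_isTop {w : Fin 2 → ℝ} (hw : IsGeneric w) {p : MvPolynomial (Fin 2) R} (hp : p ≠ 0) :
    ∃ e, IsTop w p e := by
  have hne : p.support.Nonempty := by
    rw [Finset.nonempty_iff_ne_empty, Ne, support_eq_empty]
    exact hp
  obtain ⟨e, he, hmax⟩ := Finset.exists_max_image p.support (wdeg w) hne
  refine ⟨e, he, fun e' he' hne' => lt_of_le_of_ne (hmax e' he') fun heq => hne' (hw heq)⟩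

/-- A top for `w` is a top for every positive multiple of `w`. [folklore] -/
theorem IsTop.smul_pos {w : Fin 2 → ℝ} {p : MvPolynomial (Fin 2) R} {e : Fin 2 →₀ ℕ} (h : IsTop w p e)
    {c : ℝ} (hc : 0 < c) : IsTop (c • w) p e := by
  refine ⟨h.mem, fun e' he' hne => ?_⟩
  rw [wdeg_smul, wdeg_smul]
  exact mul_lt_mul_of_pos_left (h.lt he' hne) hc

end Top

/-! ## API: the Euler weight and the Euler derivation -/

/-- The constant term has Euler weight `0`. [folklore] -/
@[simp] theorem eulerWeight_zero : eulerWeight 0 = 0 := by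
  simp [eulerWeight]

/-- The Euler weight determines the exponent (`e ↦ e₀ + μ e₁` is injective on `ℕ²`). [folklore] -/
theorem eulerWeight_injective : Function.Injective eulerWeight := by
  intro a b h
  have h0 := congrArg (fun q : Slope => q.coeff 0) h
  have h1 := congrArg (fun q : Slope => q.coeff 1) h
  simp only [eulerWeight, Polynomial.coeff_add, Polynomial.coeff_C_zero, Polynomial.coeff_X_mul_zero,
    add_zero, Polynomial.coeff_C_succ, Polynomial.coeff_X_mul, zero_add, Nat.cast_inj] at h0 h1
  ext i
  fin_cases i
  · exact h0
  · exact h1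

/-- The Euler weight is nonzero off the origin (lossless valuative Rolle). [folklore] -/
theorem eulerWeight_ne_zero {e : Fin 2 →₀ ℕ} (he : e ≠ 0) : eulerWeight e ≠ 0 := by
  rw [Ne, ← eulerWeight_zero]
  exact fun h => he (eulerWeight_injective h)

/-- The Euler weight is additive: `⟨ν, a + b⟩ = ⟨ν, a⟩ + ⟨ν, b⟩`. [folklore] -/
theorem eulerWeight_add (a b : Fin 2 →₀ ℕ) : eulerWeight (a + b) = eulerWeight a + eulerWeight b := by
  simp only [eulerWeight, Finsupp.add_apply, Nat.cast_add, map_add]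
  ring

/-- **Coefficients of `θ p`**: `coeff e (θ p) = ⟨ν,e⟩ · coeff e p`. [folklore] -/
@[simp] theorem coeff_euler (p : MvPolynomial (Fin 2) Slope) (e : Fin 2 →₀ ℕ) :
    coeff e (euler p) = eulerWeight e * coeff e p := by
  classical
  unfold euler
  rw [coeff_sum]
  simp only [coeff_monomial]
  rw [Finset.sum_ite_eq' p.support e]
  split_ifs with h
  · rfl
  · rw [notMem_support_iff] at h
    rw [h, mul_zero]

/-- `θ 0 = 0`. [folklore] -/
@[simp] theorem euler_zero : euler 0 = 0 := by
  ext e; simp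

/-- `θ` is additive. [folklore] -/
theorem euler_add (p q : MvPolynomial (Fin 2) Slope) : euler (p + q) = euler p + euler q := by
  ext e; simp [mul_add]

/-- `θ` is `ℂ[μ]`-linear. [folklore] -/
theorem euler_smul (c : Slope) (p : MvPolynomial (Fin 2) Slope) : euler (c • p) = c • euler p := by
  ext e
  simp only [coeff_euler, coeff_smul, smul_eq_mul]
  ring

/-- `θ` on a monomial: `θ(c·X^e) = ⟨ν,e⟩·c·X^e`. [folklore] -/
theorem euler_monomial (e : Fin 2 →₀ ℕ) (c : Slope) :
    euler (monomial e c) = monomial e (eulerWeight e * c) := by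
  classical
  ext e'
  simp only [coeff_euler, coeff_monomial]
  split_ifs with h
  · rw [h]
  · rw [mul_zero]

/-- `θ 1 = 0` (and `θ` kills exactly the constants). [folklore] -/
@[simp] theorem euler_one : euler (1 : MvPolynomial (Fin 2) Slope) = 0 := by
  rw [← C_1, ← monomial_zero', euler_monomial, eulerWeight_zero, zero_mul, monomial_zero]

/-- `supp θp ⊆ supp p`. [folklore] -/
theorem support_euler_subset (p : MvPolynomial (Fin 2) Slope) : (euler p).support ⊆ p.support := by
  intro e he
  rw [mem_support_iff] at he ⊢
  rw [coeff_euler] at he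
  exact right_ne_zero_of_mul he

/-- `supp θp = supp p ∖ {0}` (valuative Rolle: only the constant term is lost). [folklore] -/
theorem support_euler (p : MvPolynomial (Fin 2) Slope) : (euler p).support = p.support.erase 0 := by
  ext e
  rw [Finset.mem_erase, mem_support_iff, mem_support_iff, coeff_euler]
  constructor
  · intro h
    refine ⟨fun he => ?_, right_ne_zero_of_mul h⟩
    rw [he, eulerWeight_zero, zero_mul] at h
    exact h rfl
  · rintro ⟨hne, h⟩
    exact mul_ne_zero (eulerWeight_ne_zero hne) h

/-- **Coefficients of the iterates**: `coeff e (θ^n p) = ⟨ν,e⟩^n · coeff e p`. [folklore] -/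
@[simp] theorem coeff_euler_iterate (n : ℕ) (p : MvPolynomial (Fin 2) Slope) (e : Fin 2 →₀ ℕ) :
    coeff e (euler^[n] p) = eulerWeight e ^ n * coeff e p := by
  induction n generalizing p with
  | zero => simp
  | succ n ih =>
    rw [Function.iterate_succ_apply', coeff_euler, ih, pow_succ]
    ring

/-- The iterates are additive. [folklore] -/
theorem euler_iterate_add (n : ℕ) (p q : MvPolynomial (Fin 2) Slope) :
    euler^[n] (p + q) = euler^[n] p + euler^[n] q := by
  ext e; simp [mul_add]

/-- The iterates are `ℂ[μ]`-linear. [folklore] -/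
theorem euler_iterate_smul (n : ℕ) (c : Slope) (p : MvPolynomial (Fin 2) Slope) :
    euler^[n] (c • p) = c • euler^[n] p := by
  ext e
  simp only [coeff_euler_iterate, coeff_smul, smul_eq_mul]
  ring

/-- The iterates on a monomial. [folklore] -/
theorem euler_iterate_monomial (n : ℕ) (e : Fin 2 →₀ ℕ) (c : Slope) :
    euler^[n] (monomial e c) = monomial e (eulerWeight e ^ n * c) := by
  classical
  ext e'
  simp only [coeff_euler_iterate, coeff_monomial]
  split_ifs with h
  · rw [h]
  · rw [mul_zero]

/-- The iterates of a finite sum. [folklore] -/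
theorem euler_iterate_sum {ι : Type*} (n : ℕ) (s : Finset ι) (p : ι → MvPolynomial (Fin 2) Slope) :
    euler^[n] (∑ i ∈ s, p i) = ∑ i ∈ s, euler^[n] (p i) := by
  ext e
  simp only [coeff_euler_iterate, coeff_sum, Finset.mul_sum]

/-- The support of an iterate is contained in the support. [folklore] -/
theorem support_euler_iterate_subset (n : ℕ) (p : MvPolynomial (Fin 2) Slope) :
    (euler^[n] p).support ⊆ p.support := by
  intro e he
  rw [mem_support_iff] at he ⊢
  rw [coeff_euler_iterate] at he
  exact right_ne_zero_of_mul he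

/-! ## API: base change -/

/-- Coefficients of the base change. [folklore] -/
@[simp] theorem coeff_baseChange (p : MvPolynomial (Fin 2) ℂ) (e : Fin 2 →₀ ℕ) :
    coeff e (baseChange p) = Polynomial.C (coeff e p) := by
  simp [baseChange, coeff_map]

/-- Base change does not move the support. [folklore] -/
@[simp] theorem support_baseChange (p : MvPolynomial (Fin 2) ℂ) : (baseChange p).support = p.support := by
  unfold baseChange
  exact support_map_of_injective p Polynomial.C_injective

/-- Base change is additive. [folklore] -/
theorem baseChange_add (p q : MvPolynomial (Fin 2) ℂ) : baseChange (p + q) = baseChange p + baseChange q := by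
  simp [baseChange]

/-- Base change of a finite sum. [folklore] -/
theorem baseChange_sum {ι : Type*} (s : Finset ι) (p : ι → MvPolynomial (Fin 2) ℂ) :
    baseChange (∑ i ∈ s, p i) = ∑ i ∈ s, baseChange (p i) := by
  simp [baseChange, map_sum]

/-- Base change of a scalar multiple. [folklore] -/
theorem baseChange_smul (c : ℂ) (p : MvPolynomial (Fin 2) ℂ) :
    baseChange (c • p) = Polynomial.C c • baseChange p := by
  ext e
  simp [coeff_baseChange, coeff_smul]

/-- Base change is injective. [folklore] -/
theorem baseChange_injective : Function.Injective baseChange := by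
  intro p q h
  ext e
  have := congrArg (coeff e) h
  simpa using this

/-- Base change does not move the Newton polygon. [folklore] -/
theorem newtonVertexCount_baseChange (p : MvPolynomial (Fin 2) ℂ) :
    newtonVertexCount (baseChange p) = newtonVertexCount p := by
  unfold newtonVertexCount
  rw [support_baseChange]

/-- Tops are insensitive to base change. [folklore] -/
theorem isTop_baseChange_iff (w : Fin 2 → ℝ) (p : MvPolynomial (Fin 2) ℂ) (e : Fin 2 →₀ ℕ) :
    IsTop w (baseChange p) e ↔ IsTop w p e :=
  isTop_congr_support (support_baseChange p) e

/-! ## API: small Euler–Wronskians and the vertex count -/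

/-- The Euler–Wronskian of the empty family is `1`. [folklore] -/
theorem eulerWronskian_of_eq_zero {r : ℕ} (hr : r = 0) (u : Fin r → MvPolynomial (Fin 2) Slope) :
    eulerWronskian u = 1 := by
  subst hr
  simp [eulerWronskian]

/-- The Euler–Wronskian of a one-element family is that element. [folklore] -/
theorem eulerWronskian_of_eq_one {r : ℕ} (hr : r = 1) (u : Fin r → MvPolynomial (Fin 2) Slope) :
    eulerWronskian u = u ⟨0, by omega⟩ := by
  subst hr
  simp [eulerWronskian]

/-- The `2 × 2` Euler–Wronskian: `W(p,q) = p·θq - q·θp`. [folklore] -/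
theorem eulerWronskian_pair (p q : MvPolynomial (Fin 2) Slope) :
    eulerWronskian ![p, q] = p * euler q - q * euler p := by
  simp [eulerWronskian, Matrix.det_fin_two]

/-- The vertex count is at most the number of monomials (any coefficient semiring). [folklore] -/
theorem newtonVertexCount_le_card_support {R : Type*} [CommSemiring R] (p : MvPolynomial (Fin 2) R) :
    newtonVertexCount p ≤ p.support.card := by
  unfold newtonVertexCount
  have hfin : ((fun e : Fin 2 →₀ ℕ => fun i : Fin 2 => ((e i : ℕ) : ℝ)) ''
      (p.support : Set (Fin 2 →₀ ℕ))).Finite := p.support.finite_toSet.image _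
  calc (Set.extremePoints ℝ (convexHull ℝ ((fun e : Fin 2 →₀ ℕ => fun i : Fin 2 => ((e i : ℕ) : ℝ)) ''
        (p.support : Set (Fin 2 →₀ ℕ))))).ncard
      ≤ ((fun e : Fin 2 →₀ ℕ => fun i : Fin 2 => ((e i : ℕ) : ℝ)) '' (p.support : Set (Fin 2 →₀ ℕ))).ncard :=
        Set.ncard_le_ncard extremePoints_convexHull_subset hfin
    _ ≤ (p.support : Set (Fin 2 →₀ ℕ)).ncard := Set.ncard_image_le p.support.finite_toSet
    _ = p.support.card := Set.ncard_coe_finset _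

/-- No vertices for the zero polynomial. [folklore] -/
@[simp] theorem newtonVertexCount_zero {R : Type*} [CommSemiring R] :
    newtonVertexCount (0 : MvPolynomial (Fin 2) R) = 0 := by
  have h := newtonVertexCount_le_card_support (0 : MvPolynomial (Fin 2) R)
  rw [support_zero, Finset.card_empty] at h
  exact Nat.le_zero.mp h

/-- At most one vertex for `1`. [folklore] -/
theorem newtonVertexCount_one_le {R : Type*} [CommSemiring R] :
    newtonVertexCount (1 : MvPolynomial (Fin 2) R) ≤ 1 := by
  refine (newtonVertexCount_le_card_support _).trans ?_
  rw [← C_1, ← monomial_zero']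
  exact (Finset.card_le_card support_monomial_subset).trans (by simp)

/-- The vertex count depends only on the support. [folklore] -/
theorem newtonVertexCount_congr_support {R S : Type*} [CommSemiring R] [CommSemiring S]
    {p : MvPolynomial (Fin 2) R} {q : MvPolynomial (Fin 2) S} (h : p.support = q.support) :
    newtonVertexCount p = newtonVertexCount q := by
  unfold newtonVertexCount
  rw [h]

end Summit.ValiantsHypothesis.ValiantsHypothesis.Theorems.NewtonTauWeakVdp

end
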